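import Literature.IUT.LogThetaLattice.LatticeGlueOfKits
import Literature.IUT.LogThetaLattice.ThetaLinkOfKitsToy
import Literature.IUT.LogThetaLattice.BiCoresOfKitsToy

/-!
# Non-vacuity: a `LatticeGlueKit` over abc-iut-L5-t4's TOY kits, hence `LatticeGlue.ofKits` — the whole glued [IUTchIII] §1–§2 input — inhabited

Mochizuki, *Inter-universal Teichmüller Theory III*, kurims manuscript (May 2020), §1–§2 (Def 1.1, Prop 1.2 (vi)–(ix), Def 1.4,
Thm 1.5 (iii)–(v), Prop 2.1, Thm 2.2 (i), Cor 2.3); *II* (Dec 2020), Def 4.9 (vi)–(viii) p. 158, Cor 4.5 (ii) p. 132, Cor 4.10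
(i)–(iv) pp. 158–160; *I* (May 2020) Def 4.1 (iii)(iv) p. 96 (toy models: abc-iut-L5-t4's `PMBaseKit.toyKit`, `MultKit.toy`,
`FKit.toy`, abc-iut-L5-d4's `MonoLaws.toy` and toy rigidity theorems; this seat's `KitsToy.frame` / `timesMuSide` / `logKit` /
`thetaPMEllHT` (`StripFrameOfKitsToy`) and `KitsToy.thetaLinkKit` (`ThetaLinkOfKitsToy`)). ([IUTchIII] Cor 2.3 (i) p.72)
[claim: Mochizuki2012, status: disputed]. KIT-RULE WITNESS (plan/L6 C-duty: every interface must be shown jointly satisfiable)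
for the kit-level INPUT structures of `ThetaMonoidsOfKits` / `LatticeGlueOfKits` (with abc-iut-w4-d005's toy `BiCoricKit` and this
seat's toy `LogKit` / `ThetaLinkKit`) and for the composed pipeline `LatticeGlue.ofKits`; seat abc-iut-L6-t3 (gen 4), NV-L6 row
«LatticeGlueKit (toy kit stack)». Nothing of the series is asserted.

WHAT IS BUILT. Over the toy kits (one valuation, every ambient category the model groupoid `Model.Obj l`, the `𝒟^⊢`-prime-strips
the one-object groupoid `SingleObj Unit`, `F^{⊢×μ} := F^{⊢▶×μ} := 𝒟^⊢`, `F^{⊩▶×μ} := F^⊩`):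
* the toy `BiCoricKit` is abc-iut-w4-d005's `KitsToy.biCoricKit` (`BiCoresOfKitsToy.lean`, NV-L6 wave: shells the one-object
  groupoid, every printed orbit the full poly-isomorphism, `F(*𝔇) := *𝔇`, `F^{⊢×μ}_△(𝔇^⊢) := 𝔇^⊢`, and the [IUTchII] Cor 4.5 (ii)
  slot GENUINELY shaped: `realified := realifiedDSmall`, an `ℝ_{>0}`-torsor target) — imported, not re-typed;
* `KitsToy.thetaMonoidKit` — theta-monoid and realified categories := `SingleObj Unit`, `F^⊩_{env}(†𝔇_>)` and `†𝔉^⊩_{env}`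
  CONSTANT at the model `ℱ^⊩`-prime-strip (as abc-iut-L6-t3's toy pilots `KitsToy.thetaLinkKit`), Kummer isomorphisms identities;
* `KitsToy.thetaCoricKit`, `KitsToy.latticeGlueKit` (the eight identifications: identities / the unique isomorphism into
  the one-object groupoid), hence **`KitsToy.latticeGlue : LatticeGlue (KitsToy.frame l hl)` := `LatticeGlue.ofKits …`** with the
  [IUTchII]-side hypothesis `h` DISCHARGED on the toy (`KitsToy.fglxmToFxm_mapIso_surjective`: the toy `F^{⊢×μ}`-groupoid has
  exactly one isomorphism between any two objects), and `KitsToy.latticeDiagram` over any injective family of toy Hodge theaters.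
So the kit-level input structures are JOINTLY SATISFIABLE over abc-iut-L5-t4's own toy kits and the `…OfKits` constructors compose
end to end (`KitsToy.nonempty_latticeGlue`). HONEST FRAMING: a consistency witness over TOY kits, not an instantiation over
real Hodge theaters; the genuine kit-level functors remain the inputs BY NAME recorded in the `…OfKits` files.
-/

noncomputable section

namespace Literature.IUT.LogThetaLattice

open CategoryTheory
open Literature.IUT.HodgeTheaters Literature.IUT.HodgeTheaters.PMBaseKit
open AsSmallTransport

namespace KitsToy

variable (l : ℕ) [Fact l.Prime] (hl : l ≠ 2)

/-! ### 1. Toy helpers: the one-object groupoid `SingleObj Unit` -/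

/-- **IUTchI:Def4.1(iv)** (kurims p.96) Any two functors into the toy one-object groupoid `SingleObj Unit` (the toy `𝒟^⊢`-prime-strips, and
here also the toy log-shell / theta-monoid / realified categories) are isomorphic, by the unique morphism.
([IUTchI] Def 4.1 (iv) p.96) [claim: Mochizuki2012, status: disputed] -/
def toUnitIso {C : Type*} [Category C] (F G : C ⥤ SingleObj Unit) : F ≅ G :=
  NatIso.ofComponents (fun _ => Iso.refl _) (fun _ => rfl)

/-- **IUTchII:Cor4.10(iv)** (kurims p.160) On the toy `TimesMuSide` the composite `F^{⊩▶×μ} ↦ F^{⊢▶×μ} ↦ F^{⊢×μ}` is surjective on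
isomorphisms (the toy `F^{⊢×μ}`-groupoid has exactly one isomorphism between any two objects) — abc-iut-w4-d028's hypothesis `h`
DISCHARGED on the toy. ([IUTchII] Cor 4.10 (iv) p.160) [claim: Mochizuki2012, status: disputed] -/
theorem fglxmToFxm_mapIso_surjective (A B : (timesMuSide l hl).Fglxm) :
    Function.Surjective (fun g : A ≅ B =>
      ((timesMuSide l hl).FglxmToFvtxm ⋙ (timesMuSide l hl).FvtxmToFxm).mapIso g) := fun e =>
  ⟨(PrimeStripGroupoids.iso_nonempty_FrStrip A B).some, iso_eq_of_timesMuSide_Fxm l hl _ e⟩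

/-! ### 2. The toy `ThetaMonoidKit` and `ThetaCoricKit` (the toy `BiCoricKit` is abc-iut-w4-d005's `KitsToy.biCoricKit`) -/

/-- **IUTchIII:Prop2.1(ii)** (kurims p.58) **The toy `ThetaMonoidKit`**: theta-monoid / realified categories `SingleObj Unit`, `F^⊩_{env}(†𝔇_>)` and
`†𝔉^⊩_{env}` constant at the model `ℱ^⊩`-prime-strip (`KitsToy.frStrip`), Kummer isomorphisms identities, unit-portion
identification the unique isomorphism. ([IUTchIII] Prop 2.1 (ii) p.58) [claim: Mochizuki2012, status: disputed] -/
def thetaMonoidKit : ThetaMonoidKit (timesMuSide l hl) where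
  TM := SingleObj Unit
  RF := SingleObj Unit
  ΨenvD := (Functor.const _).obj (SingleObj.star Unit)
  ΨenvInfD := (Functor.const _).obj (SingleObj.star Unit)
  DglEnv := 𝟭 _
  ΨFenv := (Functor.const _).obj (SingleObj.star Unit)
  ΨFenvInf := (Functor.const _).obj (SingleObj.star Unit)
  CglEnv := (Functor.const _).obj (SingleObj.star Unit)
  kummerΨ := toUnitIso _ _
  kummerΨInf := toUnitIso _ _
  kummerC := toUnitIso _ _
  FglEnvD := (Functor.const _).obj (frStrip l hl)
  FglEnvHT := (Functor.const _).obj (frStrip l hl)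
  kummerFgl := NatIso.ofComponents (fun _ => Iso.refl _) (fun _ => rfl)
  fxmDeltaD := (Functor.const _).obj (SingleObj.star Unit)
  unitPortionD := toUnitIso _ _

/-- **IUTchIII:Cor2.3** (kurims p.72) **The toy `ThetaCoricKit`**: `†ℋ𝒯^𝒟 ↦ †𝔇^⊢_△` constant, `F^{⊢×μ}(†𝔇^⊢) := †𝔇^⊢`, `F^⊩_{env}(†𝔇_>)` := the
toy `ThetaMonoidKit`'s one through `†𝔇_>`, bad-prime data trivial; connectedness of the one-object `𝒟^⊢`-groupoid holds.
([IUTchIII] Cor 2.3 p.72) [claim: Mochizuki2012, status: disputed] -/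
def thetaCoricKit : ThetaCoricKit (timesMuSide l hl) where
  dvDelta := (Functor.const _).obj (SingleObj.star Unit)
  fxmOfDv := 𝟭 _
  fxmOfDv_dv := Iso.refl _
  fglEnv := DHTRep.codFunctor ⋙ (thetaMonoidKit l hl).FglEnvD
  Rbad := SingleObj Unit
  rbad := (Functor.const _).obj (SingleObj.star Unit)
  iso_nonempty_Dv _ _ := ⟨Iso.refl _⟩

/-! ### 3. The toy `LatticeGlueKit` and the glued data over the toy frame -/

/-- **IUTchIII:Cor2.3(i)** (kurims p.72) **The toy `LatticeGlueKit`**: the five toy kits with the eight identifications — identities, or the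
unique isomorphism into `SingleObj Unit`; the coherence equation holds because any two parallel morphisms of `SingleObj Unit`
coincide. ([IUTchIII] Cor 2.3 (i) p.72) [claim: Mochizuki2012, status: disputed] -/
def latticeGlueKit : LatticeGlueKit (FKit.rlfOfIsStrip_toy l hl) (timesMuSide l hl) where
  logKit := logKit l hl
  linkKit := thetaLinkKit l hl
  biCoricKit := biCoricKit l hl
  thetaMonoidKit := thetaMonoidKit l hl
  coricKit := thetaCoricKit l hl
  fglRoute_iso := toUnitIso _ _
  fxmDeltaHT_iso := toUnitIso _ _
  dvDelta_iso := toUnitIso _ _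
  fxmOfDv_iso := toUnitIso _ _
  fxmOfDv_dv_compat := by ext; rfl
  fxmDeltaD_iso := toUnitIso _ _
  fglEnv_iso := Iso.refl _
  pilotEnv_iso := (Functor.rightUnitor _).symm

/-- **IUTchIII:Cor2.3(i)** (kurims p.72) **`LatticeGlue.ofKits` IS INHABITED over the toy kits**: the glued [IUTchIII] §1–§2 data over
`KitsToy.frame` (= `StripFrame.ofKits` over abc-iut-L5-t4's toy kits with the [IUTchI] rigidity hypotheses discharged by abc-iut-L5-d4's toy
theorems), assembled by `LatticeGlue.ofKits` from the toy `LatticeGlueKit`, the [IUTchII]-side hypothesis discharged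
(`fglxmToFxm_mapIso_surjective`). ([IUTchIII] Cor 2.3 (i) p.72) [claim: Mochizuki2012, status: disputed] -/
def latticeGlue : LatticeGlue (frame l hl) :=
  LatticeGlue.ofKits (FKit.MonoLaws.toy l hl) (FKit.isomFtoDBijective_toy l hl) (FKit.isomFmtoDmSurjective_toy l hl)
    (FKit.rlfOfIsStrip_toy l hl) (timesMuSide l hl) (fglxmToFxm_mapIso_surjective l hl) (latticeGlueKit l hl)

/-- **IUTchIII:Def1.4** (kurims p.45) … together with a log-theta-lattice over its log-data and link-data for ANY injective family of toy Hodge theaters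
(the pair is an instance of the input shape of the Cor 3.12 crew's `Thm311.LinkData.ofGlue`). ([IUTchIII] Def 1.4 p.45)
[claim: Mochizuki2012, status: disputed] -/
def latticeDiagram (kind : LatticeKind) (H : ℤ × ℤ → (FKit.toy l hl).ThetaPMEllHT) (hH : Function.Injective H) :
    LogThetaLatticeDiagram (latticeGlue l hl).logData (latticeGlue l hl).linkData :=
  LatticeGlue.ofKitsDiagram _ _ _ _ _ _ _ kind H hH

/-- **IUTchIII:Cor2.3(i)** (kurims p.72) The glued interface `LatticeGlue` over the toy frame is NONEMPTY — the kit-level input structures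
`LogKit`, `ThetaLinkKit`, `BiCoricKit`, `ThetaMonoidKit`, `ThetaCoricKit`, `LatticeGlueKit` are jointly satisfiable over abc-iut-L5-t4's toy kits
and the `…OfKits` constructors compose end to end. ([IUTchIII] Cor 2.3 (i) p.72) [claim: Mochizuki2012, status: disputed] -/
theorem nonempty_latticeGlue : Nonempty (LatticeGlue (frame l hl)) := ⟨latticeGlue l hl⟩

/-- **IUTchIII:Thm1.5(iii)** (kurims p.49) Over the toy glue, `BiCores`' bi-coric `F^{⊢×μ}`-prime-strip `F^{⊢×μ}_△(𝔇^⊢)` of a `𝒟^⊢`-prime-strip IS that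
`𝒟^⊢`-prime-strip (read in the toy `F^{⊢×μ}`-groupoid). ([IUTchIII] Thm 1.5 (iii) p.49) [claim: Mochizuki2012, status: disputed] -/
theorem latticeGlue_fxmOfDv_obj (D : (frame l hl).Dv) :
    (latticeGlue l hl).biCoric.fxmOfDv.obj D = AsSmall.up.obj (ULift.down D) := rfl

end KitsToy

end Literature.IUT.LogThetaLattice

end
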